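import Summits.BirchSwinnertonDyer.Rank1Residual.X11b.BDPRouteShaAn
import HarnessLib

/-!
# Route `SchneiderFreeAdditiveX3` (rung K1 door, cell `bsd-schneider-ideate`), crux `JointLowerManin`
# — helper 1: the Gross–Zagier bookkeeping identity for `ord_p #Ш(E)_an`, MANIN-ROBUST

Helper toward item `stmt-BirchSwinnertonDyer-19180` (`JointLowerManin`, route
`route-BirchSwinnertonDyer-SchneiderFreeAdditiveX3`, rev 3): the tree's Gross–Zagier bookkeeping
identity `X11b.exists_shaAn_padicVal_eq_of_heegner` (Jetchev–Skinner–Wan 2017 (eq:gz for K′), cell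
`b2b-bsdres` sub-cell multr1-p2) RE-PROVED WITHOUT its two `p`-unit hypotheses — the Manin-type
condition `p ∤ c(Dt)` on the parametrisation constant and `ord_p u(Cd) = 0` for the model of the
twist — by carrying both valuations EXPLICITLY in the identity (FINDING cacd1ba6 of the cell: at an
ADDITIVE Eisenstein prime `p ∤ c` is Manin's conjecture at `p` for the optimal curve; but the
constant CANCELS against the `2·v_p(c)` slack of the BDP side, so the route's bookkeeping must not
assume it).

* `exists_shaAn_padicVal_eq_of_heegner_manin` — for `W/ℚ` globally minimal with `ord_{s=1} L(E,s) = 1`,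
  `K` imaginary quadratic with the Heegner hypothesis for the conductor `N` and `L(E^{d_K},1) ≠ 0`,
  `P ∈ E(K)` the Heegner point of ANY parametrisation datum `Dt` (constant `c = Dt.c`, non-zero by the
  tree theorem `ModularParametrizationData.maninConstant_ne_zero_holds`), `p` odd with `p ∤ #𝓞_K^×`,
  ANY globally minimal model `Wd = Cd • W^{(d_K)}` of the twist, and the twist's algebraic central
  value `q_d = L(E^{d_K},1)/Ω_{E^{d_K}} ∈ ℚ` (a datum): `Ш(E/ℚ)`, `Ш(E/K)` are finite,
  `ord_p #Ш(E/K) = ord_p #Ш(E) + ord_p #Ш(E^{d_K})`, and `#Ш(E)_an` is a rational `q` with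
  `ord_p q + ord_p q_d + ord_p ∏_ℓ c_ℓ(E) + 2·ord_p #E^{d_K}(ℚ)_tors + 2·v_p(c) + v_p(u(Cd))
   = 2·ord_p [E(K) : ℤP]`.
  The computation is that of `X11b.exists_shaAn_padicVal_eq_of_heegner` VERBATIM (Gross–Zagier
  `gross_zagier`, Kolyvagin `kolyvagin`, Gross–Zagier–Kolyvagin over `ℚ`, modularity, the period
  relation, heights/index in rank one, odd parts of `Ш` and torsion under quadratic base change), with
  `q = 8 I² t_W² / (n m t_K² c² w² q_d |u| c_W)` and the two valuations `v_p(c²) = 2 v_p(c)`,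
  `v_p(|u|) = v_p(u)` kept instead of being set to `0`.

Nothing is asserted beyond this kernel-checked bookkeeping; the published inputs are binders.
HONEST FRAMING: a helper for a support/crux item of a DRAFT route; BSD is not proved by any of this.

References: [JetchevSkinnerWan2017] §7.3, §7.4.1 (eq:gz for K′) (pp. 29–31 of arXiv:1512.06894);
[GrossZagier1986] V.§2; [Miller2011LMS] Def. 1.1; [CesnaviciusNeururerSaha2020] arXiv:1911.09446
Thm. 1.2 (why `p ∤ c` is not available at an additive prime).
-/

noncomputable section

open scoped Classical

open WeierstrassCurve NumberField Literature.NumberTheory.EllipticCurves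
  Literature.NumberTheory.EllipticCurves.ModularForms
  Literature.NumberTheory.EllipticCurves.Rank1Residual
  Literature.NumberTheory.EllipticCurves.KrizLi2019
  Literature.NumberTheory.QuadraticFields

namespace Summit.BirchSwinnertonDyer.BirchSwinnertonDyer.Theorems.SchneiderFree

/-- **The Gross–Zagier bookkeeping identity for `ord_p #Ш(E)_an`, Manin-robust** (Jetchev–Skinner–Wan
2017 (eq:gz for K′) with (eq:tamK) and the torsion/`Ш` descent, EXACT at an odd prime `p`, with the
parametrisation constant `c` and the twist-model unit `u` CARRIED, not assumed prime to `p`). Data: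
`W/ℚ` globally minimal of conductor `N` with `ord_{s=1} L(E,s) = 1`; `K` imaginary quadratic with the
Heegner hypothesis for `N` and `L(E^{d_K},1) ≠ 0`; `P ∈ E(K)` the Heegner point of a parametrisation
datum `Dt` (ANY constant `c = Dt.c`; `c ≠ 0` is the tree theorem `maninConstant_ne_zero_holds`); `p` odd
with `p ∤ #𝓞_K^×` (`hμ`); `Wd = Cd • W^{(d_K)}` ANY globally minimal model of the twist; and a rational
`q_d` with `L(E^{d_K},1)/Ω_{E^{d_K}} = q_d` (`hqd`; a datum — NO claim on its valuation). PUBLISHED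
inputs as binders: `hGZ` (Gross–Zagier 1986 / Cai–Shu–Tian 2014), `hKo` (Kolyvagin 1990 Thm. A),
`hGZK` (Gross–Zagier–Kolyvagin over `ℚ`), `hmod` (modularity). CONCLUSION: `Ш(E/ℚ)` and `Ш(E/K)` are
finite; `ord_p #Ш(E/K) = ord_p #Ш(E/ℚ) + ord_p #Ш(E^{d_K}/ℚ)`; and `#Ш(E)_an = q ∈ ℚ` with
`ord_p q + ord_p q_d + ord_p ∏_ℓ c_ℓ(E) + 2·ord_p #E^{d_K}(ℚ)_tors + 2·v_p(c) + v_p(u(Cd))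
 = 2·ord_p [E(K):ℤP]`
(`q = 8 I² t_W² / (n m t_K² c² w² q_d |u| c_W)`). The `p ∤ c`, `v_p(u) = 0` form is the tree's
`X11b.exists_shaAn_padicVal_eq_of_heegner`, whose computation this repeats verbatim.
[cite: JetchevSkinnerWan2017, §7.4.1 (eq:gz for K′) and §7.3.1 (eq:tamK), pp. 29–30]
[cite: GrossZagier1986, V.§2 (pp. 310–312)] [cite: Miller2011LMS, §1 and Def. 1.1] -/
theorem exists_shaAn_padicVal_eq_of_heegner_manin
    (W : WeierstrassCurve ℚ) [W.IsElliptic] [W.IsGloballyMinimal] (p : ℕ) [Fact p.Prime]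
    (N : ℕ) [NeZero N] (K : Type) [Field K] [NumberField K]
    (Dt : ModularParametrizationData W N) (H : HeegnerDatum N (NumberField.discr K)) (ι : K →+* ℂ)
    (P : (W.baseChange K).toAffine.Point)
    -- the published inputs (named facts of the tree)
    (hGZ : gross_zagier N W K) (hKo : kolyvagin N W K)
    (hGZK : rank_eq_analyticRank_of_analyticRank_le_one) (hmod : hasEntireLFunction_rat)
    -- the data
    (hK : IsImaginaryQuadratic K) (hHN : SatisfiesHeegnerHypothesis N K)
    (hP : WeierstrassCurve.Affine.Point.map ι.toRatAlgHom P = heegnerPointComplex Dt H)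
    (hp2 : p ≠ 2) (hμ : ¬ p ∣ Units.torsionOrder K)
    (hr : W.analyticRank = 1)
    (hLt : (W.quadraticTwist (NumberField.discr K : ℚ)).entireLFunction 1 ≠ 0)
    -- ANY globally minimal model of the quadratic twist by `d_K`
    (Wd : WeierstrassCurve ℚ) [Wd.IsElliptic] [Wd.IsGloballyMinimal] (Cd : VariableChange ℚ)
    (hWd : Cd • W.quadraticTwist (NumberField.discr K : ℚ) = Wd)
    -- the twist's algebraic central value (a datum)
    (qd : ℚ) (hqd : Wd.entireLFunction 1 / (Wd.realPeriodRat : ℂ) = (qd : ℂ)) :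
    Finite W.sha ∧ Finite (W.baseChange K).sha ∧
      padicValNat p (W.baseChange K).shaOrder = padicValNat p W.shaOrder + padicValNat p Wd.shaOrder ∧
      ∃ q : ℚ, shaAn W = (q : ℂ) ∧
        padicValRat p q + padicValRat p qd + padicValNat p W.tamagawaProduct +
            2 * padicValNat p Wd.torsionOrder + 2 * padicValNat p Dt.c.natAbs +
            padicValRat p (Cd.u : ℚ) =
          2 * padicValNat p (AddSubgroup.zmultiples P).index := by
  have hpp : p.Prime := Fact.out
  haveI hEK : (W.baseChange K).IsElliptic := isElliptic_baseChange' W K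
  obtain ⟨h2, hKtc⟩ := hK
  haveI : IsTotallyComplex K := hKtc
  have hD0 : (NumberField.discr K : ℚ) ≠ 0 := by exact_mod_cast NumberField.discr_ne_zero K
  haveI hEt : (W.quadraticTwist (NumberField.discr K : ℚ)).IsElliptic :=
    W.isElliptic_quadraticTwist hD0
  -- the parametrisation constant is non-zero (Edixhoven 1991 §1; tree theorem)
  have hc0 : Dt.c ≠ 0 := Dt.maninConstant_ne_zero_holds
  ---------------------------------------------------------------- `L`-values over `ℚ` and `K`
  have hL0 : W.entireLFunction 1 = 0 := entireLFunction_one_eq_zero_of_analyticRank_eq_one hr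
  obtain ⟨hlead, hderiv⟩ := leadingLCoeff_eq_deriv_of_analyticRank_eq_one hr
  have hprod := lDerivEK_eq_deriv_mul W K hmod hL0
  have hLK : LDerivEK W K ≠ 0 := by
    rw [hprod]; exact mul_ne_zero hderiv hLt
  ---------------------------------------------------------------- the Heegner point is non-torsion; Kolyvagin
  have hPH : IsHeegnerPoint N W K P := ⟨Dt, H, ι, hP⟩
  have hPinf : ¬ IsOfFinAddOrder P :=
    (lDerivEK_ne_zero_iff_not_isOfFinAddOrder W N K hGZ ⟨h2, hKtc⟩ hHN hPH).mp hLK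
  obtain ⟨hrkK, hShaK⟩ := hKo ⟨h2, hKtc⟩ hHN hPH hPinf
  haveI hfinK : Finite (W.baseChange K).sha := hShaK
  have hShaW : W.ShaFinite := Literature.NumberTheory.EllipticCurves.shaFinite_of_baseChange W K hShaK
  haveI hfinW : Finite W.sha := hShaW
  ---------------------------------------------------------------- analytic ranks
  have hrt : (W.quadraticTwist (NumberField.discr K : ℚ)).analyticRank = 0 :=
    ((W.quadraticTwist _).analyticRank_eq_zero_iff_holds (hmod _)).2 hLt
  have hrd : Wd.analyticRank = 0 := by rw [← hWd, analyticRank_smul, hrt]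
  ---------------------------------------------------------------- Gross–Zagier–Kolyvagin for `W` and `Wd`
  have hr1 : W.analyticRank ≤ 1 := le_of_eq hr
  have hrQ : W.mordellWeilRank = 1 := by rw [(hGZK W hr1).1, hr]
  have hrd1 : Wd.analyticRank ≤ 1 := by omega
  obtain ⟨hrankd, hShad⟩ := hGZK Wd hrd1
  have hrkd : Wd.mordellWeilRank = 0 := by rw [hrankd, hrd]
  haveI hfind : Finite Wd.toAffine.Point := Wd.mordellWeilRank_eq_zero_iff_holds.mp hrkd
  haveI hfinSd : Finite Wd.sha := hShad
  have htdeq : Wd.torsionOrder = Nat.card Wd.toAffine.Point := Wd.torsionOrder_eq_natCard_of_finite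
  ---------------------------------------------------------------- heights and index (Kriz–Li §2)
  obtain ⟨m, hm, hheight⟩ :=
    exists_mul_canonicalHeight_eq_index_sq_mul_regulator W K h2 hrkK hrQ P hPinf
  ---------------------------------------------------------------- Gross–Zagier and the period
  have hLD := (hGZ ⟨h2, hKtc⟩ hHN) Dt H ι P hP
  have hper := two_mul_covolume_div_sqrt_eq_bsdPeriod W K Dt h2
  have hΩ := W.realPeriod_mul_realPeriod_quadraticTwist_eq_mul_bsdPeriod K h2
  have hΩd : Wd.realPeriodRat =
      |((Cd.u : ℚ) : ℝ)| * (W.quadraticTwist (NumberField.discr K : ℚ)).realPeriodRat := by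
    rw [← hWd]; exact realPeriodRat_smul_holds (W.quadraticTwist _) Cd
  have hLt' : (W.quadraticTwist (NumberField.discr K : ℚ)).entireLFunction = Wd.entireLFunction := by
    rw [← hWd, entireLFunction_smul]
  ---------------------------------------------------------------- the twist's `L`-value
  have hΩdpos : 0 < Wd.realPeriodRat := Wd.realPeriodRat_pos_holds
  have hΩdC : (Wd.realPeriodRat : ℂ) ≠ 0 := by exact_mod_cast hΩdpos.ne'
  have hLd : Wd.entireLFunction 1 = (((qd : ℝ) * Wd.realPeriodRat : ℝ) : ℂ) := by
    have := (div_eq_iff hΩdC).mp hqd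
    rw [this]; push_cast; ring
  have hLd1 : Wd.entireLFunction 1 ≠ 0 := by rw [← hLt']; exact hLt
  have hqd0 : qd ≠ 0 := by
    intro h0
    apply hLd1
    rw [hLd, h0]; simp
  ---------------------------------------------------------------- positivity of everything
  have hΩW : 0 < W.realPeriodRat := W.realPeriodRat_pos_holds
  have hΩt : 0 < (W.quadraticTwist (NumberField.discr K : ℚ)).realPeriodRat :=
    (W.quadraticTwist _).realPeriodRat_pos_holds
  have hR : 0 < W.regulator := W.regulator_pos'
  have hcW : 0 < W.tamagawaProduct := W.tamagawaProduct_pos_holds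
  have htW : 0 < W.torsionOrder := W.torsionOrder_pos_holds
  have htK : 0 < (W.baseChange K).torsionOrder := (W.baseChange K).torsionOrder_pos_holds
  have htd : 0 < Nat.card Wd.toAffine.Point := Nat.card_pos
  have hcM : (Dt.c : ℚ) ≠ 0 := by exact_mod_cast hc0
  have hw : 0 < Units.torsionOrder K := Units.torsionOrder_pos K
  have huu : (Cd.u : ℚ) ≠ 0 := Cd.u.ne_zero
  have hm0 : 0 < m := by rcases hm with rfl | rfl <;> norm_num
  have hI0 : (AddSubgroup.zmultiples P).index ≠ 0 := by
    intro hI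
    rw [hI] at hheight
    have h0 : (m : ℝ) * ((W.baseChange K).torsionOrder : ℝ) ^ 2 * P.canonicalHeight = 0 := by
      rw [hheight]; simp
    have hh0 : P.canonicalHeight = 0 := by
      rcases mul_eq_zero.mp h0 with h' | h'
      · rcases mul_eq_zero.mp h' with h'' | h''
        · exact absurd (by exact_mod_cast h'' : m = 0) hm0.ne'
        · exact absurd (pow_eq_zero_iff two_ne_zero |>.mp h'') (by exact_mod_cast htK.ne')
      · exact h'
    exact hPinf ((Affine.Point.canonicalHeight_eq_zero_iff_holds P).mp hh0)
  set n := (W.baseChange ℝ).numRealComponents with hn_def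
  have hn : n = 1 ∨ n = 2 := numRealComponents_eq_one_or W
  have hn0 : 0 < n := by rcases hn with h' | h' <;> omega
  ---------------------------------------------------------------- the rational number `q = #Ш_an`
  set I := (AddSubgroup.zmultiples P).index with hI_def
  set q : ℚ := 8 * (I : ℚ) ^ 2 * (W.torsionOrder : ℚ) ^ 2 /
      ((n : ℚ) * (m : ℚ) * ((W.baseChange K).torsionOrder : ℚ) ^ 2 * (Dt.c : ℚ) ^ 2 *
        (Units.torsionOrder K : ℚ) ^ 2 * qd * |(Cd.u : ℚ)| * (W.tamagawaProduct : ℚ)) with hq_def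
  ---------------------------------------------------------------- real abbreviations
  set ΩW := W.realPeriodRat with hΩW_def
  set Ωt := (W.quadraticTwist (NumberField.discr K : ℚ)).realPeriodRat with hΩt_def
  set B := (W.baseChange K).bsdPeriod with hB_def
  set R := W.regulator with hR_def
  set hh := P.canonicalHeight with hhh_def
  set tK := (W.baseChange K).torsionOrder with htK_def
  set tW := W.torsionOrder with htW_def
  set td := Nat.card Wd.toAffine.Point with htd_def
  set cW := W.tamagawaProduct with hcW_def
  set w := Units.torsionOrder K with hw_def
  set cM := Dt.c with hcM_def
  set u := (Cd.u : ℚ) with hu_def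
  have hΩW' : ΩW = (W.baseChange ℝ).realPeriod := rfl
  have hΩt' : Ωt = ((W.quadraticTwist (NumberField.discr K : ℚ)).baseChange ℝ).realPeriod := rfl
  rw [← hΩW', ← hΩt'] at hΩ
  -- `B = ΩW Ωt / n`, `ĥ = 2 I² R / (m tK²)`, the Gross–Zagier constant `= 4 B / (c² w²)`
  have hBeq : B = ΩW * Ωt / n := by
    rw [hΩ]; field_simp
  have hheq : hh = 2 * (I : ℝ) ^ 2 * R / ((m : ℝ) * (tK : ℝ) ^ 2) := by
    rw [← hheight]; field_simp
  have hGZc : 2 * ZLattice.covolume Dt.L.lattice /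
        ((cM : ℝ) ^ 2 * ((w : ℝ) / 2) ^ 2 * √|(NumberField.discr K : ℝ)|) =
      4 * B / ((cM : ℝ) ^ 2 * (w : ℝ) ^ 2) := by
    rw [← hper]; field_simp; ring
  -- the `L`-values as real numbers
  have hLdr : Wd.entireLFunction 1 = (((qd : ℝ) * (|(u : ℝ)| * Ωt) : ℝ) : ℂ) := by
    rw [hLd, hΩd]
  have hLdne : ((qd : ℝ) * (|(u : ℝ)| * Ωt) : ℝ) ≠ 0 := by
    have hu' : |(u : ℝ)| ≠ 0 := abs_ne_zero.mpr (by exact_mod_cast huu)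
    have hqd' : (qd : ℝ) ≠ 0 := by exact_mod_cast hqd0
    exact mul_ne_zero hqd' (mul_ne_zero hu' hΩt.ne')
  set X : ℝ := (4 * B / ((cM : ℝ) ^ 2 * (w : ℝ) ^ 2) * hh) / ((qd : ℝ) * (|(u : ℝ)| * Ωt))
    with hX_def
  have hL1 : deriv W.entireLFunction 1 = ((X : ℝ) : ℂ) := by
    have hne : ((((qd : ℝ) * (|(u : ℝ)| * Ωt) : ℝ)) : ℂ) ≠ 0 := by exact_mod_cast hLdne
    have key : deriv W.entireLFunction 1 * ((((qd : ℝ) * (|(u : ℝ)| * Ωt) : ℝ)) : ℂ) =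
        ((4 * B / ((cM : ℝ) ^ 2 * (w : ℝ) ^ 2) * hh : ℝ) : ℂ) := by
      rw [← hLdr, ← hLt', ← hprod, hLD, hGZc]
    rw [hX_def, Complex.ofReal_div, ← key, mul_div_cancel_right₀ _ hne]
  have hshaAnR : shaAn W = ((X * (tW : ℝ) ^ 2 / (ΩW * (cW : ℝ) * R) : ℝ) : ℂ) := by
    rw [shaAn_def, hlead, hL1]
    push_cast
    rfl
  have hXq : X * (tW : ℝ) ^ 2 / (ΩW * (cW : ℝ) * R) = (q : ℝ) := by
    have hn' : (n : ℝ) ≠ 0 := by exact_mod_cast hn0.ne'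
    have hm' : (m : ℝ) ≠ 0 := by exact_mod_cast hm0.ne'
    have htK' : (tK : ℝ) ≠ 0 := by exact_mod_cast htK.ne'
    have htW' : (tW : ℝ) ≠ 0 := by exact_mod_cast htW.ne'
    have hcW' : (cW : ℝ) ≠ 0 := by exact_mod_cast hcW.ne'
    have hcM' : (cM : ℝ) ≠ 0 := by exact_mod_cast hc0
    have hw' : (w : ℝ) ≠ 0 := by exact_mod_cast hw.ne'
    have hu' : |(u : ℝ)| ≠ 0 := abs_ne_zero.mpr (by exact_mod_cast huu)
    have hI' : (I : ℝ) ≠ 0 := by exact_mod_cast hI0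
    have hqd' : (qd : ℝ) ≠ 0 := by exact_mod_cast hqd0
    rw [hX_def, hheq, hBeq, hq_def]
    push_cast
    field_simp
    ring
  have hshaAn : shaAn W = (q : ℂ) := by
    rw [hshaAnR, hXq]; norm_cast
  ---------------------------------------------------------------- `p`-adic valuations
  -- torsion: `v_p(tK) = v_p(tW) + v_p(td)`
  obtain ⟨θ, c, hθ, hcθ⟩ := Quadratic.exists_sq_eq_algebraMap (F := ℚ) (K := K) h2
  obtain ⟨qq, hqq, hdq⟩ := NumberField.exists_discr_eq_mul_sq h2 hθ hcθ
  have htors : padicValNat p tK = padicValNat p tW + padicValNat p td :=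
    padicValNat_torsionOrder_baseChange_quadratic W K h2 hθ hcθ hqq hdq ⟨Cd, hWd⟩ p hp2
  -- `Ш`: `v_p(S_K) = v_p(S_W) + v_p(S_d)`
  have hsha : padicValNat p (W.baseChange K).shaOrder =
      padicValNat p W.shaOrder + padicValNat p Wd.shaOrder := by
    have hcard := card_primaryComponent_sha_baseChange_quadratic_of_odd_of_finite W K h2 Wd
      ⟨Cd, hWd⟩ (W.baseChange K) ⟨1, one_smul _ _⟩ p hp2
    rw [WeierstrassCurve.shaOrder, WeierstrassCurve.shaOrder, WeierstrassCurve.shaOrder,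
      ← (Nat.pow_right_injective hpp.two_le).eq_iff, pow_add,
      ← natCard_primaryComponent_eq_pow_padicValNat p, ← natCard_primaryComponent_eq_pow_padicValNat p,
      ← natCard_primaryComponent_eq_pow_padicValNat p]
    exact hcard
  -- valuation of `q`
  have hI' : (I : ℚ) ≠ 0 := by exact_mod_cast hI0
  have htW' : (tW : ℚ) ≠ 0 := by exact_mod_cast htW.ne'
  have htK' : (tK : ℚ) ≠ 0 := by exact_mod_cast htK.ne'
  have hn' : (n : ℚ) ≠ 0 := by exact_mod_cast hn0.ne'
  have hm' : (m : ℚ) ≠ 0 := by exact_mod_cast hm0.ne'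
  have hcW' : (cW : ℚ) ≠ 0 := by exact_mod_cast hcW.ne'
  have hw' : (w : ℚ) ≠ 0 := by exact_mod_cast hw.ne'
  have hua : |u| ≠ 0 := abs_ne_zero.mpr huu
  have h8 : padicValRat p (8 : ℚ) = 0 := by
    rw [show (8 : ℚ) = ((8 : ℕ) : ℚ) by norm_num, padicValRat.of_nat]
    have : ¬ p ∣ 8 := by
      intro h
      have h' : p ∣ 2 ^ 3 := by simpa using h
      exact hp2 ((Nat.prime_dvd_prime_iff_eq hpp Nat.prime_two).mp (hpp.dvd_of_dvd_pow h'))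
    simp [padicValNat.eq_zero_of_not_dvd this]
  have hvn : padicValRat p (n : ℚ) = 0 := by
    rw [padicValRat.of_nat]
    have : ¬ p ∣ n := by
      rcases hn with h' | h'
      · rw [h']; exact hpp.one_lt.ne' ∘ Nat.dvd_one.mp
      · rw [h']; intro hd; exact hp2 ((Nat.prime_dvd_prime_iff_eq hpp Nat.prime_two).mp hd)
    simp [padicValNat.eq_zero_of_not_dvd this]
  have hvm : padicValRat p (m : ℚ) = 0 := by
    rw [padicValRat.of_nat]
    have : ¬ p ∣ m := by
      rcases hm with rfl | rfl
      · exact hpp.one_lt.ne' ∘ Nat.dvd_one.mp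
      · intro hd
        have h' : p ∣ 2 ^ 2 := by simpa using hd
        exact hp2 ((Nat.prime_dvd_prime_iff_eq hpp Nat.prime_two).mp (hpp.dvd_of_dvd_pow h'))
    simp [padicValNat.eq_zero_of_not_dvd this]
  -- the two valuations that are CARRIED (not assumed zero): `v_p(c)` and `v_p(u)`
  have hvc : padicValRat p (cM : ℚ) = (padicValNat p cM.natAbs : ℤ) := by
    rw [padicValRat.of_int]; rfl
  have hvw : padicValRat p (w : ℚ) = 0 := by
    rw [padicValRat.of_nat, padicValNat.eq_zero_of_not_dvd hμ]; rfl
  have hvu : padicValRat p |u| = padicValRat p u := by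
    rcases abs_choice u with h' | h'
    · rw [h']
    · rw [h', padicValRat.neg]
  have hvtd : padicValNat p Wd.torsionOrder = padicValNat p td := by rw [htdeq]
  have hval : padicValRat p q + padicValRat p qd + padicValNat p cW +
      2 * padicValNat p Wd.torsionOrder + 2 * padicValNat p cM.natAbs + padicValRat p u =
      2 * padicValNat p I := by
    -- nonvanishing of the partial products
    have hA1 : (8 : ℚ) * (I : ℚ) ^ 2 ≠ 0 := mul_ne_zero (by norm_num) (pow_ne_zero _ hI')
    have hA2 : (8 : ℚ) * (I : ℚ) ^ 2 * (tW : ℚ) ^ 2 ≠ 0 := mul_ne_zero hA1 (pow_ne_zero _ htW')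
    have hD1 : (n : ℚ) * (m : ℚ) ≠ 0 := mul_ne_zero hn' hm'
    have hD2 : (n : ℚ) * (m : ℚ) * (tK : ℚ) ^ 2 ≠ 0 := mul_ne_zero hD1 (pow_ne_zero _ htK')
    have hD3 : (n : ℚ) * (m : ℚ) * (tK : ℚ) ^ 2 * (cM : ℚ) ^ 2 ≠ 0 :=
      mul_ne_zero hD2 (pow_ne_zero _ hcM)
    have hD4 : (n : ℚ) * (m : ℚ) * (tK : ℚ) ^ 2 * (cM : ℚ) ^ 2 * (w : ℚ) ^ 2 ≠ 0 :=
      mul_ne_zero hD3 (pow_ne_zero _ hw')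
    have hD5 : (n : ℚ) * (m : ℚ) * (tK : ℚ) ^ 2 * (cM : ℚ) ^ 2 * (w : ℚ) ^ 2 * qd ≠ 0 :=
      mul_ne_zero hD4 hqd0
    have hD6 : (n : ℚ) * (m : ℚ) * (tK : ℚ) ^ 2 * (cM : ℚ) ^ 2 * (w : ℚ) ^ 2 * qd * |u| ≠ 0 :=
      mul_ne_zero hD5 hua
    have hD7 : (n : ℚ) * (m : ℚ) * (tK : ℚ) ^ 2 * (cM : ℚ) ^ 2 * (w : ℚ) ^ 2 * qd * |u| *
        (cW : ℚ) ≠ 0 := mul_ne_zero hD6 hcW'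
    have hnum : padicValRat p ((8 : ℚ) * (I : ℚ) ^ 2 * (tW : ℚ) ^ 2) =
        2 * padicValNat p I + 2 * padicValNat p tW := by
      rw [padicValRat.mul hA1 (pow_ne_zero _ htW'), padicValRat.mul (by norm_num) (pow_ne_zero _ hI'),
        padicValRat.pow, padicValRat.pow, h8, padicValRat.of_nat, padicValRat.of_nat]
      push_cast; ring
    have hden : padicValRat p ((n : ℚ) * (m : ℚ) * (tK : ℚ) ^ 2 * (cM : ℚ) ^ 2 * (w : ℚ) ^ 2 *
        qd * |u| * (cW : ℚ)) =
        2 * padicValNat p tK + 2 * padicValNat p cM.natAbs + padicValRat p qd + padicValRat p u +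
          padicValNat p cW := by
      rw [padicValRat.mul hD6 hcW', padicValRat.mul hD5 hua, padicValRat.mul hD4 hqd0,
        padicValRat.mul hD3 (pow_ne_zero _ hw'), padicValRat.mul hD2 (pow_ne_zero _ hcM),
        padicValRat.mul hD1 (pow_ne_zero _ htK'), padicValRat.mul hn' hm', padicValRat.pow,
        padicValRat.pow, padicValRat.pow, hvn, hvm, hvc, hvw, hvu, padicValRat.of_nat,
        padicValRat.of_nat]
      push_cast; ring
    rw [hq_def, padicValRat.div hA2 hD7, hnum, hden, hvtd]
    have e2 : (padicValNat p tK : ℤ) = padicValNat p tW + padicValNat p td := by exact_mod_cast htors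
    omega
  exact ⟨hfinW, hfinK, hsha, q, hshaAn, hval⟩

end Summit.BirchSwinnertonDyer.BirchSwinnertonDyer.Theorems.SchneiderFree

end
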